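import Literature.AnabelianGeometry.EtaleTheta.Discharge.Sec5Thm510iiiResidualOfGenuine

/-!
# [EtTh] §5 AT THE Ÿ̲̲-JUNCTION DATA: Lemma 5.9 (iv), the [IUTchII] Prop. 1.2 (ii) binder `hM`, and Theorem 5.10 (ii) ∧ (iii) with the bundle
# `H : Facts` DISCHARGED (pp. 330–335 / PDF pp. 104–109)

Mochizuki, *The étale theta function and its Frobenioid-theoretic manifestations*, Publ. RIMS **45** (2009)
[cite: MochizukiEtTh2009, Thm 5.10 (iii) p.334 (PDF p.108)]; Lemma 5.9 (iv) p.332 (PDF p.106); Lemma 5.8 p.331 (PDF p.105); §5 pp.330–331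
(PDF pp.104–105); Prop. 5.2 (iii) p.324 (PDF p.98); Cor. 2.18 (i) p.286 (PDF p.60).  abc-iut cell, layer L2, seat abc-iut-L2-t11 (gen 7; self-named
in-lineage row «H-FREE END FORMS AT THE Ÿ̲̲ JUNCTION DATA», the successor item (b) recorded by gen 6).  PROOF-ONLY (0 definitions, 0 new `Prop`
facts; nothing landed is edited): a knit of this lineage's END forms
* `thm510_ii_iii_ofThetaSettingData_of_cor218_i`, `monoThetaEnvCompat_ofThetaSettingData_of_cor218_i` (gen 6, `Sec5Thm510iiiResidualOfGenuine`, p458939),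
* `frdIsMonoThetaEnv_ofThetaSettingData_of_originClause`, `envIsoBiTheta_ofThetaSettingData_of_originClause` (gen 4, `Sec5Lem59ivOfThetaSetting`, p441744)
with abc-iut-L2-t4's `facts_ofThetaSettingYddData_of_constantsDictionary` (`Sec5OfThetaSettingConstantsDictionary`, p440765: at the §5 data of the
Setting with `A_⊙^bs := Ÿ̲̲`, i.e. over `BiKummerSetting.mkOfThetaSettingYdd C e μ hC hS tf hZ hP NH`, the bundle `Facts` — the printed §5 facts
`s^⊓-gp_N`/`s^⊔-gp_N` relations, [FrdI] Prop. 5.6, Prop. 4.3 (iii), Aut-ampleness of `B_N`, the arithmetic step of Lemma 5.8, epimorphicity of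
`s^⊓_N, s^⊔_N` — FOLLOWS from Def. 3.6 (iii)'s `hconst` and the ONE constants-dictionary binder `hD`).

WHAT DISAPPEARS.  Every END form of record at the junction `ofThetaSettingData` (general `A_⊙`) carries the binder `H : Facts`.  At the Ÿ̲̲-junction
data that binder is a THEOREM (⟸ {`hconst`, `hD`}, both already displayed), so it is discharged here.  The five §5 laws `h1 : SectionsFactor`,
`h3 : OuterActionLZ`, `hsec : SgpCapSection`, `hcs : SgpCupSection`, `h8 : ConstantsEqNormalizer` through which abc-iut-L2-t4 DEFINES the object
`E^Π_N = 𝔉.frdMonoThetaEnv h1 h3 hsec hcs h8 DK` are `Prop`-valued, hence proof-irrelevant: the conclusions below are stated for ARBITRARY such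
proof arguments (the shape the [IUTchII] Prop. 1.2 (ii) consumer `Literature.IUT.HodgeArakelov.exists_envOfFrobenioid_frdMonoThetaEnv` displays),
and are proved from the `Facts`-instantiated END forms by definitional proof irrelevance; the `_canonical` variants display NO law binder at all
(`h3` is abc-iut-L2-t4's unconditional theorem `outerActionLZ_of`; `h1`, `hsec`, `hcs`, `h8` are supplied by `Facts` ⟸ {`hconst`, `hD`}).

RESIDUAL OF RECORD AT THE Ÿ̲̲-JUNCTION DATA (numbers, not adjectives): the junction data (`tf`, `h`, `Q`, the roots `R`, `K'`, `constEmb`, `hinvc`,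
`hinvp`), `hconst` (Def. 3.6 (iii)), the ONE dictionary binder `hD`, a cyclotome reading `m`; PLUS, per statement: Lemma 5.9 (iv) / `hM` — the
Prop. 5.2 (iii) ORIGIN CLAUSE `hΘ` (GAP G-L2t4-2, pin `θ := Θ̈`); Theorem 5.10 (iii) — Theorem 5.10 (ii) as typed (`hii`) or, for (ii) ∧ (iii),
Theorem 5.7 / Theorem 4.4 (iv) AS TYPED (`RootTransportWith`, `StrvTransport` with the 1-compatible `Ψ^bs` and the Ψ^birat datum
`(ΨbiratAut, hsq, hΨconst)`), the representative `ψY` (`hbase`, `hψY`, `hψYdd`), and F-0620 (Cor. 2.18 (i)) at `C.rigidData μ hC hS h15 L`.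
NO `H : Facts`, NO `hsemi`, NO raw `hΔ`, NO `hY`/`hYdd`/`hopenX`/`hK` (theorems of abc-iut-L2-t4 / temperedness / `hD`).
HONEST FRAMING: kernel-checked compositions of landed theorems over the typed junction; `tf` (the tempered Frobenioid of the curve) is an abstract
parameter, not inhabited in the tree; F-0620 is a named (unproved, instance-form) fact consumed as a hypothesis; nothing of [EtTh] is asserted
unconditionally; typed ≠ proved; no side is taken on anything downstream ([IUTchIII] Cor. 3.12).
-/

noncomputable section

namespace Literature.AnabelianGeometry.EtaleTheta

open CategoryTheory Opposite Literature.AlgebraicGeometry.Frobenioids Literature.AnabelianGeometry.SemiGraphs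
  Literature.AnabelianGeometry.SemiGraphs.GaloisObjects Literature.AlgebraicGeometry.Frobenioids.QuasiTemperoid.BTempConnected
open scoped Pointwise

universe v₀

namespace ThetaFrobenioid

section YddJunction

variable {p : ℕ} [Fact p.Prime] {D : ThetaSetting p} {E : D.EtaleThetaData} {l : ℕ} {C : E.DoubleUnderline l}
  {e : D.toTemperedCurve.GroupLevelData} {N : ℕ+} (μ : D.CyclotomeMod l N) (hC : D.Compat) (hS : D.Sec2Hyps)
  {D₀ : Type} [Category.{v₀} D₀] {V : FrdIMonoidStub.{0}} {T₀ : RealifiedDivisorMonoids (D₀ := D₀) V}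
  {VD : FrdICatStub.{1, 0, 0} (ConnectedPart (BTemp (C.temperedArithmeticGroup e).Pi))}
  {tf : TemperedFrobenioid T₀ (ConnectedPart (BTemp (C.temperedArithmeticGroup e).Pi)) VD} {hZ : tf.monoidType = MonoidType.Z}
  {hP : ∀ A : (ConnectedPart (BTemp (C.temperedArithmeticGroup e).Pi))ᵒᵖ, IsPerfect (tf.Φ.carrier A)}
  {NH : Subgroup (Field.absoluteGaloisGroup D.K) → tf.category → ℕ+ → Prop}
  {pullFrac : ∀ {A A' : (BiKummerSetting.mkOfThetaSettingYdd C e μ hC hS tf hZ hP NH).C} (_ : A' ⟶ A),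
    (BiKummerSetting.mkOfThetaSettingYdd C e μ hC hS tf hZ hP NH).biratUnits A →
      (BiKummerSetting.mkOfThetaSettingYdd C e μ hC hS tf hZ hP NH).biratUnits A'}
  {θ : (BiKummerSetting.mkOfThetaSettingYdd C e μ hC hS tf hZ hP NH).biratUnits (BiKummerSetting.mkOfThetaSettingYdd C e μ hC hS tf hZ hP NH).Aodot}
  {Bl : (BiKummerSetting.mkOfThetaSettingYdd C e μ hC hS tf hZ hP NH).C}
  {Pl : (BiKummerSetting.mkOfThetaSettingYdd C e μ hC hS tf hZ hP NH).FractionPair θ Bl}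
  {Rl : (BiKummerSetting.mkOfThetaSettingYdd C e μ hC hS tf hZ hP NH).NthRoot θ Pl C.lPNat pullFrac}
  (h : ModelFrobenioid.Hypotheses tf.divisorMonoid tf.ratFnFunctor)
  (Q : FrobenioidTheta.ThetaSubquotientStub.{0} (ConnectedPart (BTemp (C.temperedArithmeticGroup e).Pi)))
  (R : (BiKummerSetting.mkOfThetaSettingYdd C e μ hC hS tf hZ hP NH).NthRoot Rl.root Rl.pair N pullFrac)
  (K' : Type) [Field K'] (constEmb : K'ˣ →* tf.biratUnitsModel R.BN) (constEmb_injective : Function.Injective constEmb)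
  (hinvc : ∀ g : Aut R.AN.base,
    pull tf.divisorMonoid g.hom (ModelFrobenioid.div R.pair.num) = ModelFrobenioid.div R.pair.num)
  (hinvp : ∀ y : (C.thetaEnvData μ hC hS).PiX, y ∈ (C.thetaEnvData μ hC hS).PiYdd →
    pull tf.divisorMonoid ((BiKummerSetting.mkOfThetaSettingYdd C e μ hC hS tf hZ hP NH).galoisSurj
      R.AN.base R.αData.isGalois ((ContinuousMulEquiv.refl _) y)).hom (ModelFrobenioid.div R.pair.den) = ModelFrobenioid.div R.pair.den)
  (hconst : ∀ (ε : Aut R.BN) (k : K'ˣ), tf.biratAutModel R.BN ε (constEmb k) = constEmb k)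
  (m : (ofThetaSettingData μ hC hS h Q R K' constEmb constEmb_injective hinvc hinvp).muTorsion
      (ofThetaSettingData μ hC hS h Q R K' constEmb constEmb_injective hinvc hinvp).BN N ≃* (C.thetaEnvData μ hC hS).mu)
  {Cst : Subgroup ((ofThetaSettingData μ hC hS h Q R K' constEmb constEmb_injective hinvc hinvp).biratUnits
      (ofThetaSettingData μ hC hS h Q R K' constEmb constEmb_injective hinvc hinvp).BN)}
  {ν' : Cst →* (PadicAlgCl p)ˣ}
  (hD : BiratAutAction.ConstantsDictionary
    (biratAutAction_ofConnectedTemperoidData (T := C.thetaEnvData μ hC hS) h Q C.odd_lPNat R (ContinuousMulEquiv.refl _) K' constEmb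
      constEmb_injective hinvc hinvp hconst) C μ hC hS (ContinuousMulEquiv.refl _) m Cst ν')
  (h15 : ThetaSetting.Prop15iii E hC) (L : C.CuspLabels)

/-! ### Lemma 5.9 (iv) in full and the [IUTchII] Prop. 1.2 (ii) binder `hM`, modulo the Prop. 5.2 (iii) origin clause, `Facts` discharged -/

include hD

/-- **[EtTh] Lemma 5.9 (iv) IN FULL for the §5 data OF THE SETTING with `A_⊙^bs := Ÿ̲̲`, `Facts` DISCHARGED** (abc-iut-L2-t4's `EnvIsoBiTheta`:
"the natural inclusions `μ_N(B_N) ↪ E_N`, `Im(Π^tp_Y) ⊆ E_N` determine an isomorphism of topological groups `E^Π_N ⥲ Π^tp_Y[μ_N]` which is an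
isomorphism of mod `N` bi-theta environments") at the honest `DK`, for ARBITRARY proofs `h1 h3 hsec hcs h8` of the five §5 laws defining `E^Π_N`
(proof-irrelevant).  Residual: the data, `hconst`, `hD`, `m`, the Prop. 5.2 (iii) origin clause `hΘ`.  Gen 4's
`envIsoBiTheta_ofThetaSettingData_of_originClause` ∘ p440765's `facts_ofThetaSettingYddData_of_constantsDictionary`.
[cite: MochizukiEtTh2009, Lem 5.9 (iv) p.332 (PDF p.106); Prop 5.2 (iii) p.324 (PDF p.98)] -/
theorem envIsoBiTheta_ofThetaSettingYdd_of_originClause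
    (hΘ : (fun k : (C.thetaEnvData μ hC hS).PiYdd =>
        (m ((ofThetaSettingData μ hC hS h Q R K' constEmb constEmb_injective hinvc hinvp).diffCocycle
          (facts_ofThetaSettingYddData_of_constantsDictionary (hD' := hD)) k))⁻¹) ∈ C.thetaCocycles hC μ)
    (h1 : (ofThetaSettingData μ hC hS h Q R K' constEmb constEmb_injective hinvc hinvp).SectionsFactor)
    (h3 : (ofThetaSettingData μ hC hS h Q R K' constEmb constEmb_injective hinvc hinvp).OuterActionLZ)
    (hsec : (ofThetaSettingData μ hC hS h Q R K' constEmb constEmb_injective hinvc hinvp).SgpCapSection)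
    (hcs : (ofThetaSettingData μ hC hS h Q R K' constEmb constEmb_injective hinvc hinvp).SgpCupSection)
    (h8 : (ofThetaSettingData μ hC hS h Q R K' constEmb constEmb_injective hinvc hinvp).ConstantsEqNormalizer) :
    (ofThetaSettingData μ hC hS h Q R K' constEmb constEmb_injective hinvc hinvp).EnvIsoBiTheta h1 h3 hsec hcs h8
      (dkOfConnectedTemperoidData (T := C.thetaEnvData μ hC hS) h Q C.odd_lPNat R (ContinuousMulEquiv.refl _) K' constEmb
        constEmb_injective hinvc hinvp hconst
        (kxRootNModCyclotome_ofThetaSettingData_of_constantsDictionary μ hC hS h Q R K' constEmb constEmb_injective hinvc hinvp hconst m hD))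
      (C.thetaEnvData μ hC hS) (ContinuousMulEquiv.refl _) :=
  envIsoBiTheta_ofThetaSettingData_of_originClause μ hC hS h Q R K' constEmb constEmb_injective hinvc hinvp hconst m hD
    (facts_ofThetaSettingYddData_of_constantsDictionary (hD' := hD)) hΘ

/-- **The [IUTchII] Prop. 1.2 (ii) binder `hM` for the §5 data OF THE SETTING with `A_⊙^bs := Ÿ̲̲`, `Facts` DISCHARGED** — [EtTh] Lemma 5.9 (iv)
"In particular, omitting the homomorphism `s^⊓-Π_N` yields a mod `N` mono-theta environment" (abc-iut-L2-t4's `FrdIsMonoThetaEnv` at the honest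
`DK`, for ARBITRARY proofs `h1 h3 hsec hcs h8` of the laws defining `E^Π_N` — the shape displayed by the consumer
`Literature.IUT.HodgeArakelov.exists_envOfFrobenioid_frdMonoThetaEnv`).  RESIDUAL EXACTLY: the data, `hconst`, the ONE dictionary binder `hD`, `m`, the
origin clause `hΘ` (GAP G-L2t4-2).  [cite: MochizukiEtTh2009, Lem 5.9 (iv) p.332 (PDF p.106); Prop 5.2 (iii) p.324 (PDF p.98)] -/
theorem frdIsMonoThetaEnv_ofThetaSettingYdd_of_originClause
    (hΘ : (fun k : (C.thetaEnvData μ hC hS).PiYdd =>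
        (m ((ofThetaSettingData μ hC hS h Q R K' constEmb constEmb_injective hinvc hinvp).diffCocycle
          (facts_ofThetaSettingYddData_of_constantsDictionary (hD' := hD)) k))⁻¹) ∈ C.thetaCocycles hC μ)
    (h1 : (ofThetaSettingData μ hC hS h Q R K' constEmb constEmb_injective hinvc hinvp).SectionsFactor)
    (h3 : (ofThetaSettingData μ hC hS h Q R K' constEmb constEmb_injective hinvc hinvp).OuterActionLZ)
    (hsec : (ofThetaSettingData μ hC hS h Q R K' constEmb constEmb_injective hinvc hinvp).SgpCapSection)
    (hcs : (ofThetaSettingData μ hC hS h Q R K' constEmb constEmb_injective hinvc hinvp).SgpCupSection)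
    (h8 : (ofThetaSettingData μ hC hS h Q R K' constEmb constEmb_injective hinvc hinvp).ConstantsEqNormalizer) :
    (ofThetaSettingData μ hC hS h Q R K' constEmb constEmb_injective hinvc hinvp).FrdIsMonoThetaEnv h1 h3 hsec hcs h8
      (dkOfConnectedTemperoidData (T := C.thetaEnvData μ hC hS) h Q C.odd_lPNat R (ContinuousMulEquiv.refl _) K' constEmb
        constEmb_injective hinvc hinvp hconst
        (kxRootNModCyclotome_ofThetaSettingData_of_constantsDictionary μ hC hS h Q R K' constEmb constEmb_injective hinvc hinvp hconst m hD))
      (C.thetaEnvData μ hC hS) :=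
  frdIsMonoThetaEnv_ofThetaSettingData_of_originClause μ hC hS h Q R K' constEmb constEmb_injective hinvc hinvp hconst m hD
    (facts_ofThetaSettingYddData_of_constantsDictionary (hD' := hD)) hΘ

/-- **`hM` with NO law binder displayed** (`_canonical`): as above with the five proof arguments SUPPLIED by `Facts` ⟸ {`hconst`, `hD`} — the
[IUTchII] Prop. 1.2 (ii) binder at the Ÿ̲̲-junction data modulo EXACTLY {data, `hconst`, `hD`, `m`, origin clause `hΘ`}.
[cite: MochizukiEtTh2009, Lem 5.9 (iv) p.332 (PDF p.106); Prop 5.2 (iii) p.324 (PDF p.98)] -/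
theorem frdIsMonoThetaEnv_ofThetaSettingYdd_of_originClause_canonical
    (hΘ : (fun k : (C.thetaEnvData μ hC hS).PiYdd =>
        (m ((ofThetaSettingData μ hC hS h Q R K' constEmb constEmb_injective hinvc hinvp).diffCocycle
          (facts_ofThetaSettingYddData_of_constantsDictionary (hD' := hD)) k))⁻¹) ∈ C.thetaCocycles hC μ) :
    (ofThetaSettingData μ hC hS h Q R K' constEmb constEmb_injective hinvc hinvp).FrdIsMonoThetaEnv
      (facts_ofThetaSettingYddData_of_constantsDictionary (hD' := hD)).sectionsFactor
      (ofThetaSettingData μ hC hS h Q R K' constEmb constEmb_injective hinvc hinvp).outerActionLZ_of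
      (facts_ofThetaSettingYddData_of_constantsDictionary (hD' := hD)).sgpCapSection
      (facts_ofThetaSettingYddData_of_constantsDictionary (hD' := hD)).sgpCupSection
      (facts_ofThetaSettingYddData_of_constantsDictionary (hD' := hD)).constantsEqNormalizer
      (dkOfConnectedTemperoidData (T := C.thetaEnvData μ hC hS) h Q C.odd_lPNat R (ContinuousMulEquiv.refl _) K' constEmb
        constEmb_injective hinvc hinvp hconst
        (kxRootNModCyclotome_ofThetaSettingData_of_constantsDictionary μ hC hS h Q R K' constEmb constEmb_injective hinvc hinvp hconst m hD))
      (C.thetaEnvData μ hC hS) :=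
  frdIsMonoThetaEnv_ofThetaSettingYdd_of_originClause μ hC hS h Q R K' constEmb constEmb_injective hinvc hinvp hconst m hD hΘ _ _ _ _ _

/-! ### Theorem 5.10 (iii), and (ii) ∧ (iii), with `Facts` discharged and `hΔ` from F-0620 -/

/-- **[EtTh] Theorem 5.10 (iii) (abc-iut-L2-t4's `MonoThetaEnvCompat`) for the §5 data OF THE SETTING with `A_⊙^bs := Ÿ̲̲`, `Facts` DISCHARGED
and the clause `hΔ` DISCHARGED from F-0620** (gen 6's `monoThetaEnvCompat_ofThetaSettingData_of_cor218_i` ∘ p440765's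
`facts_ofThetaSettingYddData_of_constantsDictionary`), for ARBITRARY proofs `h1 h3 hsec hcs h8` of the laws defining `E^Π_N`.  Residual: the data,
`hconst`, `hD`, `m`, Theorem 5.10 (ii) as typed (`hii`) with the representative `ψY`, F-0620 at `C.rigidData μ hC hS h15 L`.
[cite: MochizukiEtTh2009, Thm 5.10 (iii) p.334–335 (PDF pp.108–109); Cor 2.18 (i) p.286 (PDF p.60)] -/
theorem monoThetaEnvCompat_ofThetaSettingYdd_of_cor218_i (h218 : (C.rigidData μ hC hS h15 L).Cor218_i)
    (h1 : (ofThetaSettingData μ hC hS h Q R K' constEmb constEmb_injective hinvc hinvp).SectionsFactor)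
    (h3 : (ofThetaSettingData μ hC hS h Q R K' constEmb constEmb_injective hinvc hinvp).OuterActionLZ)
    (hsec : (ofThetaSettingData μ hC hS h Q R K' constEmb constEmb_injective hinvc hinvp).SgpCapSection)
    (hcs : (ofThetaSettingData μ hC hS h Q R K' constEmb constEmb_injective hinvc hinvp).SgpCupSection)
    (h8 : (ofThetaSettingData μ hC hS h Q R K' constEmb constEmb_injective hinvc hinvp).ConstantsEqNormalizer)
    (Ψ : (BiKummerSetting.mkOfThetaSettingYdd C e μ hC hS tf hZ hP NH).C ≌ (BiKummerSetting.mkOfThetaSettingYdd C e μ hC hS tf hZ hP NH).C)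
    (β : Ψ.functor.obj (ofThetaSettingData μ hC hS h Q R K' constEmb constEmb_injective hinvc hinvp).BN ≅
      (ofThetaSettingData μ hC hS h Q R K' constEmb constEmb_injective hinvc hinvp).BN)
    (ΨbiratAut : (ofThetaSettingData μ hC hS h Q R K' constEmb constEmb_injective hinvc hinvp).biratUnits
        (ofThetaSettingData μ hC hS h Q R K' constEmb constEmb_injective hinvc hinvp).BN ≃*
      (ofThetaSettingData μ hC hS h Q R K' constEmb constEmb_injective hinvc hinvp).biratUnits
        (ofThetaSettingData μ hC hS h Q R K' constEmb constEmb_injective hinvc hinvp).BN)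
    (hii : (ofThetaSettingData μ hC hS h Q R K' constEmb constEmb_injective hinvc hinvp).PsiAutPreserves Ψ β ΨbiratAut)
    (ψY : (ofThetaSettingData μ hC hS h Q R K' constEmb constEmb_injective hinvc hinvp).PiX ≃ₜ*
      (ofThetaSettingData μ hC hS h Q R K' constEmb constEmb_injective hinvc hinvp).PiX)
    (hbase : ∀ g, (ofThetaSettingData μ hC hS h Q R K' constEmb constEmb_injective hinvc hinvp).autBase
        (ofThetaSettingData μ hC hS h Q R K' constEmb constEmb_injective hinvc hinvp).BN
        ((ofThetaSettingData μ hC hS h Q R K' constEmb constEmb_injective hinvc hinvp).psiAut Ψ β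
          ((ofThetaSettingData μ hC hS h Q R K' constEmb constEmb_injective hinvc hinvp).sgpCap
            ((ofThetaSettingData μ hC hS h Q R K' constEmb constEmb_injective hinvc hinvp).ρ g))) =
      (ofThetaSettingData μ hC hS h Q R K' constEmb constEmb_injective hinvc hinvp).ρ (ψY g))
    (hψY : (ofThetaSettingData μ hC hS h Q R K' constEmb constEmb_injective hinvc hinvp).PiY.map ψY.toMulEquiv.toMonoidHom =
      (ofThetaSettingData μ hC hS h Q R K' constEmb constEmb_injective hinvc hinvp).PiY)
    (hψYdd : (ofThetaSettingData μ hC hS h Q R K' constEmb constEmb_injective hinvc hinvp).PiYdd.map ψY.toMulEquiv.toMonoidHom =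
      (ofThetaSettingData μ hC hS h Q R K' constEmb constEmb_injective hinvc hinvp).PiYdd) :
    (ofThetaSettingData μ hC hS h Q R K' constEmb constEmb_injective hinvc hinvp).MonoThetaEnvCompat h1 h3 hsec hcs h8
      (dkOfConnectedTemperoidData (T := C.thetaEnvData μ hC hS) h Q C.odd_lPNat R (ContinuousMulEquiv.refl _) K' constEmb
        constEmb_injective hinvc hinvp hconst
        (kxRootNModCyclotome_ofThetaSettingData_of_constantsDictionary μ hC hS h Q R K' constEmb constEmb_injective hinvc hinvp hconst m hD))
      Ψ β ψY hbase hψY hψYdd :=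
  monoThetaEnvCompat_ofThetaSettingData_of_cor218_i μ hC hS h Q R K' constEmb constEmb_injective hinvc hinvp hconst m hD h15 L h218 h1 h3
    hsec hcs h8 (facts_ofThetaSettingYddData_of_constantsDictionary (hD' := hD)) Ψ β ΨbiratAut hii ψY hbase hψY hψYdd

/-- **[EtTh] Theorem 5.10 (ii) ∧ (iii) FOR THE §5 DATA OF THE SETTING with `A_⊙^bs := Ÿ̲̲` — `Facts` DISCHARGED** (gen 6's
`thm510_ii_iii_ofThetaSettingData_of_cor218_i` ∘ p440765's `facts_ofThetaSettingYddData_of_constantsDictionary`), for ARBITRARY proofs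
`h1 h3 hsec hcs h8` of the laws defining `E^Π_N`: from Theorem 5.7 and Theorem 4.4 (iv) AS TYPED (the transports `RootTransportWith`, `StrvTransport`
with the 1-compatible `Ψ^bs` and the Ψ^birat datum `(ΨbiratAut, hsq, hΨconst)`), `hconst`, the ONE dictionary binder `hD`, `m`, the representative
`ψY`, and F-0620 at the setting's rigidity data — NO `H : Facts`, no `hsemi`, no raw `hΔ`.
[cite: MochizukiEtTh2009, Thm 5.10 (ii)(iii) p.333–335 (PDF pp.107–109); Thm 5.7 p.329 (PDF p.103); Thm 4.4 (iv) p.320 (PDF p.94); Cor 2.18 (i) p.286 (PDF p.60)] -/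
theorem thm510_ii_iii_ofThetaSettingYdd_of_cor218_i (h218 : (C.rigidData μ hC hS h15 L).Cor218_i)
    (h1 : (ofThetaSettingData μ hC hS h Q R K' constEmb constEmb_injective hinvc hinvp).SectionsFactor)
    (h3 : (ofThetaSettingData μ hC hS h Q R K' constEmb constEmb_injective hinvc hinvp).OuterActionLZ)
    (hsec : (ofThetaSettingData μ hC hS h Q R K' constEmb constEmb_injective hinvc hinvp).SgpCapSection)
    (hcs : (ofThetaSettingData μ hC hS h Q R K' constEmb constEmb_injective hinvc hinvp).SgpCupSection)
    (h8 : (ofThetaSettingData μ hC hS h Q R K' constEmb constEmb_injective hinvc hinvp).ConstantsEqNormalizer)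
    (Ψ : (BiKummerSetting.mkOfThetaSettingYdd C e μ hC hS tf hZ hP NH).C ≌ (BiKummerSetting.mkOfThetaSettingYdd C e μ hC hS tf hZ hP NH).C)
    (β : Ψ.functor.obj (ofThetaSettingData μ hC hS h Q R K' constEmb constEmb_injective hinvc hinvp).BN ≅
      (ofThetaSettingData μ hC hS h Q R K' constEmb constEmb_injective hinvc hinvp).BN)
    (ΨbiratAut : (ofThetaSettingData μ hC hS h Q R K' constEmb constEmb_injective hinvc hinvp).biratUnits
        (ofThetaSettingData μ hC hS h Q R K' constEmb constEmb_injective hinvc hinvp).BN ≃*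
      (ofThetaSettingData μ hC hS h Q R K' constEmb constEmb_injective hinvc hinvp).biratUnits
        (ofThetaSettingData μ hC hS h Q R K' constEmb constEmb_injective hinvc hinvp).BN)
    (Ψbs : ConnectedPart (BTemp (C.temperedArithmeticGroup e).Pi) ⥤ ConnectedPart (BTemp (C.temperedArithmeticGroup e).Pi))
    [Ψbs.Faithful]
    (eΨ : Ψ.functor ⋙ (ofThetaSettingData μ hC hS h Q R K' constEmb constEmb_injective hinvc hinvp).base ≅
      (ofThetaSettingData μ hC hS h Q R K' constEmb constEmb_injective hinvc hinvp).base ⋙ Ψbs)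
    (hsq : ∀ u : (ofThetaSettingData μ hC hS h Q R K' constEmb constEmb_injective hinvc hinvp).units
        (ofThetaSettingData μ hC hS h Q R K' constEmb constEmb_injective hinvc hinvp).BN,
      ∀ hu : (ofThetaSettingData μ hC hS h Q R K' constEmb constEmb_injective hinvc hinvp).psiAut Ψ β u ∈
        (ofThetaSettingData μ hC hS h Q R K' constEmb constEmb_injective hinvc hinvp).units
          (ofThetaSettingData μ hC hS h Q R K' constEmb constEmb_injective hinvc hinvp).BN,
      ΨbiratAut ((ofThetaSettingData μ hC hS h Q R K' constEmb constEmb_injective hinvc hinvp).unitsToBirat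
          (ofThetaSettingData μ hC hS h Q R K' constEmb constEmb_injective hinvc hinvp).BN u) =
        (ofThetaSettingData μ hC hS h Q R K' constEmb constEmb_injective hinvc hinvp).unitsToBirat
          (ofThetaSettingData μ hC hS h Q R K' constEmb constEmb_injective hinvc hinvp).BN ⟨_, hu⟩)
    (hΨconst : (ofThetaSettingData μ hC hS h Q R K' constEmb constEmb_injective hinvc hinvp).constEmb.range.map ΨbiratAut.toMonoidHom =
      (ofThetaSettingData μ hC hS h Q R K' constEmb constEmb_injective hinvc hinvp).constEmb.range)
    (αA : Ψ.functor.obj (ofThetaSettingData μ hC hS h Q R K' constEmb constEmb_injective hinvc hinvp).AN ≅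
      (ofThetaSettingData μ hC hS h Q R K' constEmb constEmb_injective hinvc hinvp).AN)
    (eA : (ofThetaSettingData μ hC hS h Q R K' constEmb constEmb_injective hinvc hinvp).AN ≅
      (ofThetaSettingData μ hC hS h Q R K' constEmb constEmb_injective hinvc hinvp).AN)
    (Dc Dp : Aut (ofThetaSettingData μ hC hS h Q R K' constEmb constEmb_injective hinvc hinvp).BN)
    (hRT : (ofThetaSettingData μ hC hS h Q R K' constEmb constEmb_injective hinvc hinvp).RootTransportWith Ψ αA β eA Dc Dp)
    (θA : Aut ((ofThetaSettingData μ hC hS h Q R K' constEmb constEmb_injective hinvc hinvp).base.obj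
        (ofThetaSettingData μ hC hS h Q R K' constEmb constEmb_injective hinvc hinvp).BN) ≃*
      Aut ((ofThetaSettingData μ hC hS h Q R K' constEmb constEmb_injective hinvc hinvp).base.obj
        (ofThetaSettingData μ hC hS h Q R K' constEmb constEmb_injective hinvc hinvp).BN))
    (hST : (ofThetaSettingData μ hC hS h Q R K' constEmb constEmb_injective hinvc hinvp).StrvTransport Ψ αA eA θA)
    (hθY : (ofThetaSettingData μ hC hS h Q R K' constEmb constEmb_injective hinvc hinvp).imPiY.map θA.toMonoidHom =
      (ofThetaSettingData μ hC hS h Q R K' constEmb constEmb_injective hinvc hinvp).imPiY)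
    (hθYdd : (ofThetaSettingData μ hC hS h Q R K' constEmb constEmb_injective hinvc hinvp).HB.map θA.toMonoidHom =
      (ofThetaSettingData μ hC hS h Q R K' constEmb constEmb_injective hinvc hinvp).HB)
    (ψY : (ofThetaSettingData μ hC hS h Q R K' constEmb constEmb_injective hinvc hinvp).PiX ≃ₜ*
      (ofThetaSettingData μ hC hS h Q R K' constEmb constEmb_injective hinvc hinvp).PiX)
    (hbase : ∀ g, (ofThetaSettingData μ hC hS h Q R K' constEmb constEmb_injective hinvc hinvp).autBase
        (ofThetaSettingData μ hC hS h Q R K' constEmb constEmb_injective hinvc hinvp).BN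
        ((ofThetaSettingData μ hC hS h Q R K' constEmb constEmb_injective hinvc hinvp).psiAut Ψ β
          ((ofThetaSettingData μ hC hS h Q R K' constEmb constEmb_injective hinvc hinvp).sgpCap
            ((ofThetaSettingData μ hC hS h Q R K' constEmb constEmb_injective hinvc hinvp).ρ g))) =
      (ofThetaSettingData μ hC hS h Q R K' constEmb constEmb_injective hinvc hinvp).ρ (ψY g))
    (hψY : (ofThetaSettingData μ hC hS h Q R K' constEmb constEmb_injective hinvc hinvp).PiY.map ψY.toMulEquiv.toMonoidHom =
      (ofThetaSettingData μ hC hS h Q R K' constEmb constEmb_injective hinvc hinvp).PiY)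
    (hψYdd : (ofThetaSettingData μ hC hS h Q R K' constEmb constEmb_injective hinvc hinvp).PiYdd.map ψY.toMulEquiv.toMonoidHom =
      (ofThetaSettingData μ hC hS h Q R K' constEmb constEmb_injective hinvc hinvp).PiYdd) :
    (ofThetaSettingData μ hC hS h Q R K' constEmb constEmb_injective hinvc hinvp).PsiAutPreserves Ψ β ΨbiratAut ∧
      (ofThetaSettingData μ hC hS h Q R K' constEmb constEmb_injective hinvc hinvp).MonoThetaEnvCompat h1 h3 hsec hcs h8
        (dkOfConnectedTemperoidData (T := C.thetaEnvData μ hC hS) h Q C.odd_lPNat R (ContinuousMulEquiv.refl _) K' constEmb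
          constEmb_injective hinvc hinvp hconst
          (kxRootNModCyclotome_ofThetaSettingData_of_constantsDictionary μ hC hS h Q R K' constEmb constEmb_injective hinvc hinvp hconst m hD))
        Ψ β ψY hbase hψY hψYdd :=
  thm510_ii_iii_ofThetaSettingData_of_cor218_i μ hC hS h Q R K' constEmb constEmb_injective hinvc hinvp hconst m hD h15 L h218
    (facts_ofThetaSettingYddData_of_constantsDictionary (hD' := hD)) Ψ β ΨbiratAut Ψbs eΨ hsq hΨconst αA eA Dc Dp hRT θA hST hθY hθYdd
    ψY hbase hψY hψYdd

/-- **Theorem 5.10 (ii) ∧ (iii) at the Ÿ̲̲-junction data with NO law binder displayed** (`_canonical`): the previous theorem with the five proof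
arguments SUPPLIED (`h3 :=` abc-iut-L2-t4's theorem `outerActionLZ_of`; `h1, hsec, hcs, h8 :=` the fields of `Facts` ⟸ {`hconst`, `hD`}) — the END
form of record: RESIDUAL EXACTLY {junction data, `hconst`, `hD`, `m`, Thm. 5.7 / Thm. 4.4 (iv) as typed with `Ψ^bs` and the Ψ^birat datum, the
representative `ψY`, F-0620 at `C.rigidData μ hC hS h15 L` (+ `h15`, `L`)}.
[cite: MochizukiEtTh2009, Thm 5.10 (ii)(iii) p.333–335 (PDF pp.107–109); Cor 2.18 (i) p.286 (PDF p.60)] -/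
theorem thm510_ii_iii_ofThetaSettingYdd_of_cor218_i_canonical (h218 : (C.rigidData μ hC hS h15 L).Cor218_i)
    (Ψ : (BiKummerSetting.mkOfThetaSettingYdd C e μ hC hS tf hZ hP NH).C ≌ (BiKummerSetting.mkOfThetaSettingYdd C e μ hC hS tf hZ hP NH).C)
    (β : Ψ.functor.obj (ofThetaSettingData μ hC hS h Q R K' constEmb constEmb_injective hinvc hinvp).BN ≅
      (ofThetaSettingData μ hC hS h Q R K' constEmb constEmb_injective hinvc hinvp).BN)
    (ΨbiratAut : (ofThetaSettingData μ hC hS h Q R K' constEmb constEmb_injective hinvc hinvp).biratUnits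
        (ofThetaSettingData μ hC hS h Q R K' constEmb constEmb_injective hinvc hinvp).BN ≃*
      (ofThetaSettingData μ hC hS h Q R K' constEmb constEmb_injective hinvc hinvp).biratUnits
        (ofThetaSettingData μ hC hS h Q R K' constEmb constEmb_injective hinvc hinvp).BN)
    (Ψbs : ConnectedPart (BTemp (C.temperedArithmeticGroup e).Pi) ⥤ ConnectedPart (BTemp (C.temperedArithmeticGroup e).Pi))
    [Ψbs.Faithful]
    (eΨ : Ψ.functor ⋙ (ofThetaSettingData μ hC hS h Q R K' constEmb constEmb_injective hinvc hinvp).base ≅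
      (ofThetaSettingData μ hC hS h Q R K' constEmb constEmb_injective hinvc hinvp).base ⋙ Ψbs)
    (hsq : ∀ u : (ofThetaSettingData μ hC hS h Q R K' constEmb constEmb_injective hinvc hinvp).units
        (ofThetaSettingData μ hC hS h Q R K' constEmb constEmb_injective hinvc hinvp).BN,
      ∀ hu : (ofThetaSettingData μ hC hS h Q R K' constEmb constEmb_injective hinvc hinvp).psiAut Ψ β u ∈
        (ofThetaSettingData μ hC hS h Q R K' constEmb constEmb_injective hinvc hinvp).units
          (ofThetaSettingData μ hC hS h Q R K' constEmb constEmb_injective hinvc hinvp).BN,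
      ΨbiratAut ((ofThetaSettingData μ hC hS h Q R K' constEmb constEmb_injective hinvc hinvp).unitsToBirat
          (ofThetaSettingData μ hC hS h Q R K' constEmb constEmb_injective hinvc hinvp).BN u) =
        (ofThetaSettingData μ hC hS h Q R K' constEmb constEmb_injective hinvc hinvp).unitsToBirat
          (ofThetaSettingData μ hC hS h Q R K' constEmb constEmb_injective hinvc hinvp).BN ⟨_, hu⟩)
    (hΨconst : (ofThetaSettingData μ hC hS h Q R K' constEmb constEmb_injective hinvc hinvp).constEmb.range.map ΨbiratAut.toMonoidHom =
      (ofThetaSettingData μ hC hS h Q R K' constEmb constEmb_injective hinvc hinvp).constEmb.range)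
    (αA : Ψ.functor.obj (ofThetaSettingData μ hC hS h Q R K' constEmb constEmb_injective hinvc hinvp).AN ≅
      (ofThetaSettingData μ hC hS h Q R K' constEmb constEmb_injective hinvc hinvp).AN)
    (eA : (ofThetaSettingData μ hC hS h Q R K' constEmb constEmb_injective hinvc hinvp).AN ≅
      (ofThetaSettingData μ hC hS h Q R K' constEmb constEmb_injective hinvc hinvp).AN)
    (Dc Dp : Aut (ofThetaSettingData μ hC hS h Q R K' constEmb constEmb_injective hinvc hinvp).BN)
    (hRT : (ofThetaSettingData μ hC hS h Q R K' constEmb constEmb_injective hinvc hinvp).RootTransportWith Ψ αA β eA Dc Dp)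
    (θA : Aut ((ofThetaSettingData μ hC hS h Q R K' constEmb constEmb_injective hinvc hinvp).base.obj
        (ofThetaSettingData μ hC hS h Q R K' constEmb constEmb_injective hinvc hinvp).BN) ≃*
      Aut ((ofThetaSettingData μ hC hS h Q R K' constEmb constEmb_injective hinvc hinvp).base.obj
        (ofThetaSettingData μ hC hS h Q R K' constEmb constEmb_injective hinvc hinvp).BN))
    (hST : (ofThetaSettingData μ hC hS h Q R K' constEmb constEmb_injective hinvc hinvp).StrvTransport Ψ αA eA θA)
    (hθY : (ofThetaSettingData μ hC hS h Q R K' constEmb constEmb_injective hinvc hinvp).imPiY.map θA.toMonoidHom =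
      (ofThetaSettingData μ hC hS h Q R K' constEmb constEmb_injective hinvc hinvp).imPiY)
    (hθYdd : (ofThetaSettingData μ hC hS h Q R K' constEmb constEmb_injective hinvc hinvp).HB.map θA.toMonoidHom =
      (ofThetaSettingData μ hC hS h Q R K' constEmb constEmb_injective hinvc hinvp).HB)
    (ψY : (ofThetaSettingData μ hC hS h Q R K' constEmb constEmb_injective hinvc hinvp).PiX ≃ₜ*
      (ofThetaSettingData μ hC hS h Q R K' constEmb constEmb_injective hinvc hinvp).PiX)
    (hbase : ∀ g, (ofThetaSettingData μ hC hS h Q R K' constEmb constEmb_injective hinvc hinvp).autBase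
        (ofThetaSettingData μ hC hS h Q R K' constEmb constEmb_injective hinvc hinvp).BN
        ((ofThetaSettingData μ hC hS h Q R K' constEmb constEmb_injective hinvc hinvp).psiAut Ψ β
          ((ofThetaSettingData μ hC hS h Q R K' constEmb constEmb_injective hinvc hinvp).sgpCap
            ((ofThetaSettingData μ hC hS h Q R K' constEmb constEmb_injective hinvc hinvp).ρ g))) =
      (ofThetaSettingData μ hC hS h Q R K' constEmb constEmb_injective hinvc hinvp).ρ (ψY g))
    (hψY : (ofThetaSettingData μ hC hS h Q R K' constEmb constEmb_injective hinvc hinvp).PiY.map ψY.toMulEquiv.toMonoidHom =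
      (ofThetaSettingData μ hC hS h Q R K' constEmb constEmb_injective hinvc hinvp).PiY)
    (hψYdd : (ofThetaSettingData μ hC hS h Q R K' constEmb constEmb_injective hinvc hinvp).PiYdd.map ψY.toMulEquiv.toMonoidHom =
      (ofThetaSettingData μ hC hS h Q R K' constEmb constEmb_injective hinvc hinvp).PiYdd) :
    (ofThetaSettingData μ hC hS h Q R K' constEmb constEmb_injective hinvc hinvp).PsiAutPreserves Ψ β ΨbiratAut ∧
      (ofThetaSettingData μ hC hS h Q R K' constEmb constEmb_injective hinvc hinvp).MonoThetaEnvCompat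
        (facts_ofThetaSettingYddData_of_constantsDictionary (hD' := hD)).sectionsFactor
        (ofThetaSettingData μ hC hS h Q R K' constEmb constEmb_injective hinvc hinvp).outerActionLZ_of
        (facts_ofThetaSettingYddData_of_constantsDictionary (hD' := hD)).sgpCapSection
        (facts_ofThetaSettingYddData_of_constantsDictionary (hD' := hD)).sgpCupSection
        (facts_ofThetaSettingYddData_of_constantsDictionary (hD' := hD)).constantsEqNormalizer
        (dkOfConnectedTemperoidData (T := C.thetaEnvData μ hC hS) h Q C.odd_lPNat R (ContinuousMulEquiv.refl _) K' constEmb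
          constEmb_injective hinvc hinvp hconst
          (kxRootNModCyclotome_ofThetaSettingData_of_constantsDictionary μ hC hS h Q R K' constEmb constEmb_injective hinvc hinvp hconst m hD))
        Ψ β ψY hbase hψY hψYdd :=
  thm510_ii_iii_ofThetaSettingYdd_of_cor218_i μ hC hS h Q R K' constEmb constEmb_injective hinvc hinvp hconst m hD h15 L h218 _ _ _ _ _
    Ψ β ΨbiratAut Ψbs eΨ hsq hΨconst αA eA Dc Dp hRT θA hST hθY hθYdd ψY hbase hψY hψYdd

end YddJunction

end ThetaFrobenioid

end Literature.AnabelianGeometry.EtaleTheta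

end

-- tree-health (abc-iut-w6-d081 g5, 2026-08-26T19:49Z): comment-only re-land of a STRANDED ACCEPT (accepted 18:45–18:54Z; serial farm import probe at 19:40Z answers rc 75 «remote:stale:unbuilt» while the lane builds p90 < 2 min since 18:30Z);
-- declarations byte-identical to the accepted version; purpose = trigger the rebuild. No content change.
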